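import Mathlib.MeasureTheory.Constructions.Pi
import Mathlib.Analysis.Fourier.AddCircle
import Literature.Analysis.FunctionSpaces.TorusCalculusProofs
import Literature.Analysis.FunctionSpaces.TorusFourierCalculus
import Literature.Analysis.FunctionSpaces.TorusSobolevNorm
import Literature.Analysis.FunctionSpaces.TorusSpaceTime
import Literature.Analysis.FunctionSpaces.TorusTrigPoly
import HarnessLib

/-!
# Time-periodic space–time fields on `T^n` read on the space–time torus `T^{1+n}`

Analysis/FunctionSpaces support file (definitions with bodies + proved theorems; no named
facts). A space–time field `u : ℝ → T^n → F` which is `τ`-periodic in time is the same thing as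
a function `U` on the torus `T^{1+n} = UnitAddTorus (Fin (n+1))` (time = coordinate `0`, space =
the coordinates `Fin.succ i`), `U(s, x) = u(τ s, x)`; joint smoothness of `u`
(`Torus.IsSmoothSpaceTimeOn univ`) is smoothness of `U` (`Torus.IsSmooth`), the time derivative
becomes `τ⁻¹ ∂₀` and the spatial operators act slice-wise. This is the dictionary by which the
whole Fourier toolkit of the tree on `UnitAddTorus d` (`TorusFourierCalculus`,
`TorusFourierSynthesis`: coefficients of derivatives and products, rapid decay, synthesis,
uniqueness) becomes available for time-periodic problems — here for the persistence of
time-periodic Navier–Stokes orbits (`Literature.Analysis.FluidPDE.PeriodicNSOrbitPersists`), in the space–time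
Fourier formulation of Iooss (Arch. Rational Mech. Anal. 47 (1972)) and Kielhöfer
(*Bifurcation Theory*, 2nd ed. 2012, §I.8).

* `Torus.timeSlice U c` — the slice `x ↦ U (Fin.cons c x)` at circle time `c`;
* `Torus.timeRoll τ u` — the rolled-up field `y ↦ u (τ · s(y₀)) (tail y)` (`s(y₀) ∈ [0,1)` the
  representative of `y₀`); for `τ`-periodic `u`, `timeRoll τ u (Fin.cons ↑s x) = u (τ s) x`
  (`Torus.timeRoll_cons`);
* smoothness both ways (`Torus.isSmooth_timeRoll`, `Torus.IsSmooth.timeSlice`,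
  `Torus.isSmoothSpaceTimeOn_cons`), and the derivative dictionary: `∂_{i+1}` commutes with
  slicing (`Torus.partialDeriv_succ_cons`, exact), `∂₀ (timeRoll τ u) = τ ∂ₜu`
  (`Torus.partialDeriv_zero_timeRoll`), Laplacian / convective derivative / gradient /
  divergence of slices;
* Fubini `T^{1+n} = T¹ × T^n` (`Torus.integral_eq_integral_cons`, Mathlib's
  `volume_preserving_piFinSuccAbove`) and the **slice formula for Fourier coefficients**
  `𝓕U(m, k) = ∫_{T¹} e_{-m}(s) 𝓕(U(s,·))(k) ds` (`Torus.mFourierCoeff_cons`), with the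
  character integral `∫_{T¹} e_m = [m = 0]` and its corollaries for functions with constant
  slice coefficients (time-independent functions, slice means);
* conjugate symmetry of the coefficients of complexified real fields with values in `ℝ^ι`
  (`Torus.conjVec_mFourierCoeff_complexify`, any index type `ι`).

## References

* L. Grafakos, *Classical Fourier Analysis*, 3rd ed. (2014), §3.1 (Fourier analysis on `Tⁿ`,
  Fubini on the product torus). [folklore material]
* G. Iooss, Arch. Rational Mech. Anal. 47 (1972) 301–329 (space–time Fourier treatment of
  time-periodic Navier–Stokes problems).
-/

noncomputable section

open MeasureTheory Set Function Filter UnitAddTorus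
open scoped BigOperators Topology ContDiff

namespace Literature.Analysis.FunctionSpaces

namespace Torus

variable {n : ℕ} {F : Type*}

/-! ## Time slices and the rolled-up field -/

section Defs

/-- The **time slice** of a function on the space–time torus `T^{1+n}` at circle time `c`:
`timeSlice U c x = U (Fin.cons c x)`. [folklore] -/
def timeSlice (U : UnitAddTorus (Fin (n + 1)) → F) (c : UnitAddCircle) : UnitAddTorus (Fin n) → F :=
  fun x => U (Fin.cons c x)

/-- Unfolding `timeSlice`. [folklore] -/
@[simp]
theorem timeSlice_apply (U : UnitAddTorus (Fin (n + 1)) → F) (c : UnitAddCircle) (x : UnitAddTorus (Fin n)) :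
    timeSlice U c x = U (Fin.cons c x) :=
  rfl

/-- The **rolled-up field**: a space–time field `u : ℝ → T^n → F`, read on `T^{1+n}` with time
rescaled by `τ`, `timeRoll τ u y = u (τ s) (tail y)` where `s ∈ [0,1)` represents `y₀`
(Mathlib's `AddCircle.equivIco`). Meaningful for `τ`-periodic `u` (`timeRoll_cons`). [folklore] -/
def timeRoll (τ : ℝ) (u : ℝ → UnitAddTorus (Fin n) → F) : UnitAddTorus (Fin (n + 1)) → F :=
  fun y => u (τ * ((AddCircle.equivIco (1 : ℝ) 0 (y 0) : ℝ))) (Fin.tail y)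

/-- **The rolled-up field on a point `(s, x)`**: for `τ`-periodic `u`,
`timeRoll τ u (Fin.cons ↑s x) = u (τ s) x`. [folklore] -/
theorem timeRoll_cons {τ : ℝ} {u : ℝ → UnitAddTorus (Fin n) → F} (hu : Function.Periodic u τ) (s : ℝ)
    (x : UnitAddTorus (Fin n)) :
    timeRoll τ u (Fin.cons ((s : ℝ) : UnitAddCircle) x) = u (τ * s) x := by
  simp only [timeRoll, Fin.cons_zero, Fin.tail_cons]
  rw [AddCircle.coe_equivIco_mk_apply, div_one, mul_one]
  have h1 : τ * Int.fract s = τ * s - (⌊s⌋ : ℤ) * τ := by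
    rw [Int.fract]; ring
  rw [h1]
  exact congrFun (hu.sub_int_mul_eq ⌊s⌋) x

/-- The time slices of the rolled-up field are the time slices of the field:
`timeSlice (timeRoll τ u) ↑s = u (τ s)`. [folklore] -/
theorem timeSlice_timeRoll {τ : ℝ} {u : ℝ → UnitAddTorus (Fin n) → F} (hu : Function.Periodic u τ) (s : ℝ) :
    timeSlice (timeRoll τ u) ((s : ℝ) : UnitAddCircle) = u (τ * s) :=
  funext fun x => timeRoll_cons hu s x

/-- Every point of the circle is `↑s` for a real `s`, every point of `T^{1+n}` is `Fin.cons ↑s x`.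
[folklore] -/
theorem exists_eq_cons (y : UnitAddTorus (Fin (n + 1))) :
    ∃ (s : ℝ) (x : UnitAddTorus (Fin n)), y = Fin.cons ((s : ℝ) : UnitAddCircle) x := by
  obtain ⟨s, hs⟩ := QuotientAddGroup.mk_surjective (y 0)
  exact ⟨s, Fin.tail y, by rw [hs, Fin.cons_self_tail]⟩

/-- Reading a function on `T^{1+n}` as a space–time field with time period `ω⁻¹`:
`(t, x) ↦ U (Fin.cons ↑(ω t) x)` is `ω⁻¹`-periodic in `t`. [folklore] -/
theorem periodic_comp_cons (U : UnitAddTorus (Fin (n + 1)) → F) {om : ℝ} (hom : om ≠ 0) :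
    Function.Periodic (fun t : ℝ => fun x : UnitAddTorus (Fin n) =>
      U (Fin.cons (((om * t : ℝ)) : UnitAddCircle) x)) om⁻¹ := by
  intro t
  funext x
  have : ((om * (t + om⁻¹) : ℝ) : UnitAddCircle) = ((om * t : ℝ) : UnitAddCircle) := by
    rw [mul_add, mul_inv_cancel₀ hom, AddCircle.coe_add_period]
  simp only [this]

/-- Rolling up the field read from `U` gives back `U`. [folklore] -/
theorem timeRoll_comp_cons (U : UnitAddTorus (Fin (n + 1)) → F) {om : ℝ} (hom : om ≠ 0) :
    timeRoll om⁻¹ (fun t : ℝ => fun x : UnitAddTorus (Fin n) =>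
      U (Fin.cons (((om * t : ℝ)) : UnitAddCircle) x)) = U := by
  funext y
  obtain ⟨s, x, rfl⟩ := exists_eq_cons y
  rw [timeRoll_cons (periodic_comp_cons U hom), ← mul_assoc, mul_inv_cancel₀ hom, one_mul]

end Defs

/-! ## Smoothness -/

section Smooth

variable [NormedAddCommGroup F] [NormedSpace ℝ F]

/-- The coordinates of `Fin.cons` depend smoothly (in fact linearly) on head and tail: the map
`(a, y) ↦ (a, y₀, …, y_{n-1}) : ℝ × ℝⁿ → ℝ^{1+n}`, composed with `t ↦ b t` affine in the head,
is smooth. [folklore] -/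
theorem contDiff_cons_affine (b c : ℝ) :
    ContDiff ℝ ∞ (fun p : ℝ × EuclideanSpace ℝ (Fin n) =>
      (WithLp.toLp 2 (Fin.cons (b * p.1 + c) (WithLp.ofLp p.2)) : EuclideanSpace ℝ (Fin (n + 1)))) := by
  rw [contDiff_euclidean]
  intro i
  refine Fin.cases ?_ (fun j => ?_) i
  · simp only [Fin.cons_zero]
    exact (contDiff_const.mul contDiff_fst).add contDiff_const
  · simp only [Fin.cons_succ]
    exact (contDiff_euclidean.1 contDiff_snd) j

/-- The linear map `z ↦ (a z₀, (z₁, …, z_n)) : ℝ^{1+n} → ℝ × ℝⁿ` is smooth. [folklore] -/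
theorem contDiff_uncons (a : ℝ) :
    ContDiff ℝ ∞ (fun z : EuclideanSpace ℝ (Fin (n + 1)) =>
      ((a * z 0, WithLp.toLp 2 fun i : Fin n => z (Fin.succ i)) : ℝ × EuclideanSpace ℝ (Fin n))) := by
  refine ContDiff.prodMk ?_ ?_
  · exact contDiff_const.mul ((contDiff_euclidean.1 contDiff_id) 0)
  · rw [contDiff_euclidean]
    intro j
    exact (contDiff_euclidean.1 contDiff_id) (Fin.succ j)

/-- `proj` of a `Fin.cons` vector is the `Fin.cons` of the projections. [folklore] -/
theorem proj_toLp_cons (a : ℝ) (v : Fin n → ℝ) :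
    proj (WithLp.toLp 2 (Fin.cons a v) : EuclideanSpace ℝ (Fin (n + 1))) =
      Fin.cons ((a : ℝ) : UnitAddCircle) (proj (WithLp.toLp 2 v)) := by
  funext i
  refine Fin.cases ?_ (fun j => ?_) i
  · simp [proj_apply]
  · simp [proj_apply]

/-- A point of `ℝ^{1+n}` projects to the `Fin.cons` of the projections of head and tail. [folklore] -/
theorem proj_eq_cons (z : EuclideanSpace ℝ (Fin (n + 1))) :
    proj z = Fin.cons ((z 0 : ℝ) : UnitAddCircle) (proj (WithLp.toLp 2 fun i : Fin n => z (Fin.succ i))) := by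
  funext i
  refine Fin.cases ?_ (fun j => ?_) i
  · simp [proj_apply]
  · simp [proj_apply]

/-- **Time slices of smooth functions are smooth.** [folklore] -/
theorem IsSmooth.timeSlice {U : UnitAddTorus (Fin (n + 1)) → F} (hU : IsSmooth U) (c : UnitAddCircle) :
    IsSmooth (timeSlice U c) := by
  obtain ⟨a, rfl⟩ := QuotientAddGroup.mk_surjective c
  have hA := contDiff_cons_affine (n := n) 0 a
  have he : lift (Torus.timeSlice U ((a : ℝ) : UnitAddCircle)) =
      (lift U ∘ fun p : ℝ × EuclideanSpace ℝ (Fin n) =>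
        (WithLp.toLp 2 (Fin.cons (0 * p.1 + a) (WithLp.ofLp p.2)) : EuclideanSpace ℝ (Fin (n + 1)))) ∘
        fun y : EuclideanSpace ℝ (Fin n) => ((0 : ℝ), y) := by
    funext y
    simp only [lift_apply, Function.comp_apply, timeSlice_apply, zero_mul, zero_add]
    rw [proj_toLp_cons, WithLp.toLp_ofLp]
  unfold IsSmooth
  rw [he]
  exact (hU.comp hA).comp (contDiff_prodMk_right (0 : ℝ))

/-- **The rolled-up field of a jointly smooth periodic field is smooth on `T^{1+n}`.** [folklore] -/
theorem isSmooth_timeRoll {τ : ℝ} {u : ℝ → UnitAddTorus (Fin n) → F} (hu : IsSmoothSpaceTimeOn univ u)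
    (hper : Function.Periodic u τ) : IsSmooth (timeRoll τ u) := by
  have hA := contDiff_uncons (n := n) τ
  have he : lift (timeRoll τ u) = stLift u ∘ fun z : EuclideanSpace ℝ (Fin (n + 1)) =>
      ((τ * z 0, WithLp.toLp 2 fun i : Fin n => z (Fin.succ i)) : ℝ × EuclideanSpace ℝ (Fin n)) := by
    funext z
    simp only [lift_apply, Function.comp_apply, stLift_apply]
    rw [proj_eq_cons z, timeRoll_cons hper]
  have hst : ContDiff ℝ ∞ (stLift u) := by
    rw [← contDiffOn_univ, ← univ_prod_univ]; exact hu
  unfold IsSmooth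
  rw [he]
  exact hst.comp hA

/-- **Reading a smooth function on `T^{1+n}` as a space–time field gives a jointly smooth
field**: `(t, x) ↦ U (Fin.cons ↑(ω t) x)` is `IsSmoothSpaceTimeOn univ`. [folklore] -/
theorem isSmoothSpaceTimeOn_cons {U : UnitAddTorus (Fin (n + 1)) → F} (hU : IsSmooth U) (om : ℝ) :
    IsSmoothSpaceTimeOn univ (fun t : ℝ => fun x : UnitAddTorus (Fin n) =>
      U (Fin.cons (((om * t : ℝ)) : UnitAddCircle) x)) := by
  have hB := contDiff_cons_affine (n := n) om 0
  have he : stLift (fun t : ℝ => fun x : UnitAddTorus (Fin n) => U (Fin.cons (((om * t : ℝ)) : UnitAddCircle) x)) =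
      lift U ∘ fun p : ℝ × EuclideanSpace ℝ (Fin n) =>
        (WithLp.toLp 2 (Fin.cons (om * p.1 + 0) (WithLp.ofLp p.2)) : EuclideanSpace ℝ (Fin (n + 1))) := by
    funext p
    simp only [lift_apply, Function.comp_apply, add_zero]
    rw [proj_toLp_cons]
    rfl
  change ContDiffOn ℝ ∞ (stLift _) _
  rw [he]
  exact (hU.comp hB).contDiffOn

end Smooth

/-! ## The derivative dictionary -/

section Deriv

variable [NormedAddCommGroup F] [NormedSpace ℝ F]

/-- Moving along the spatial coordinate line `e_{j+1}` from `Fin.cons c x` is moving along `e_j`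
in the slice. [folklore] -/
theorem cons_add_proj_smul_single_succ (c : UnitAddCircle) (x : UnitAddTorus (Fin n)) (j : Fin n) (r : ℝ) :
    (Fin.cons c x : UnitAddTorus (Fin (n + 1))) + proj (r • EuclideanSpace.single (Fin.succ j) (1 : ℝ)) =
      Fin.cons c (x + proj (r • EuclideanSpace.single j (1 : ℝ))) := by
  funext i
  refine Fin.cases ?_ (fun i' => ?_) i
  · simp [proj_apply, (Fin.succ_ne_zero j).symm]
  · simp [proj_apply, Fin.succ_inj]

/-- Moving along the time coordinate line `e₀` from `Fin.cons ↑s x` is moving `s`. [folklore] -/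
theorem cons_add_proj_smul_single_zero (s : ℝ) (x : UnitAddTorus (Fin n)) (r : ℝ) :
    (Fin.cons ((s : ℝ) : UnitAddCircle) x : UnitAddTorus (Fin (n + 1))) +
        proj (r • EuclideanSpace.single (0 : Fin (n + 1)) (1 : ℝ)) =
      Fin.cons (((s + r : ℝ)) : UnitAddCircle) x := by
  funext i
  refine Fin.cases ?_ (fun i' => ?_) i
  · simp [proj_apply]
  · simp [proj_apply, Fin.succ_ne_zero]

/-- **Spatial derivatives commute with slicing** (an identity of the difference quotients, no
regularity needed): `∂_{j+1} U (Fin.cons c x) = ∂_j (timeSlice U c) x`. [folklore] -/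
theorem partialDeriv_succ_cons (U : UnitAddTorus (Fin (n + 1)) → F) (j : Fin n) (c : UnitAddCircle)
    (x : UnitAddTorus (Fin n)) :
    partialDeriv (Fin.succ j) U (Fin.cons c x) = partialDeriv j (timeSlice U c) x := by
  simp only [partialDeriv, Torus.lineDeriv, timeSlice_apply, cons_add_proj_smul_single_succ]

/-- `∂_{j+1} U`, sliced, is `∂_j` of the slice (function form of `partialDeriv_succ_cons`). [folklore] -/
theorem timeSlice_partialDeriv_succ (U : UnitAddTorus (Fin (n + 1)) → F) (j : Fin n) (c : UnitAddCircle) :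
    timeSlice (partialDeriv (Fin.succ j) U) c = partialDeriv j (timeSlice U c) :=
  funext fun x => partialDeriv_succ_cons U j c x

/-- The time derivative on the torus is the derivative along `s ↦ U (Fin.cons ↑s x)`. [folklore] -/
theorem partialDeriv_zero_cons (U : UnitAddTorus (Fin (n + 1)) → F) (s : ℝ) (x : UnitAddTorus (Fin n)) :
    partialDeriv 0 U (Fin.cons ((s : ℝ) : UnitAddCircle) x) =
      deriv (fun r : ℝ => U (Fin.cons ((r : ℝ) : UnitAddCircle) x)) s := by
  simp only [partialDeriv, Torus.lineDeriv, cons_add_proj_smul_single_zero]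
  have h := deriv_comp_const_add (fun r' : ℝ => U (Fin.cons ((r' : ℝ) : UnitAddCircle) x)) s 0
  rw [add_zero] at h
  exact h

/-- **Time derivative of the rolled-up field**: for a jointly smooth `τ`-periodic `u`,
`∂₀ (timeRoll τ u) (Fin.cons ↑s x) = τ • ∂ₜu (τ s) x`. [folklore] -/
theorem partialDeriv_zero_timeRoll {τ : ℝ} {u : ℝ → UnitAddTorus (Fin n) → F}
    (hu : IsSmoothSpaceTimeOn univ u) (hper : Function.Periodic u τ) (s : ℝ) (x : UnitAddTorus (Fin n)) :
    partialDeriv 0 (timeRoll τ u) (Fin.cons ((s : ℝ) : UnitAddCircle) x) =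
      τ • timeDerivWithin univ u (τ * s) x := by
  rw [partialDeriv_zero_cons]
  simp only [timeRoll_cons hper]
  have hd : HasDerivAt (fun t : ℝ => u t x) (timeDerivWithin univ u (τ * s) x) (τ * s) :=
    (hu.hasDerivWithinAt_slice (mem_univ _) x).hasDerivAt Filter.univ_mem
  have hl : HasDerivAt (fun r : ℝ => τ * r) τ s := by
    simpa using (hasDerivAt_id s).const_mul τ
  have h := hd.scomp s hl
  exact h.deriv

/-- **Laplacian of a slice**: for smooth `U`, `Δ (timeSlice U c) x = ∑_i ∂_{i+1}∂_{i+1} U (Fin.cons c x)`.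
[folklore] -/
theorem laplacian_timeSlice {U : UnitAddTorus (Fin (n + 1)) → F} (hU : IsSmooth U) (c : UnitAddCircle)
    (x : UnitAddTorus (Fin n)) :
    laplacian (timeSlice U c) x = ∑ i : Fin n, partialDeriv (Fin.succ i) (partialDeriv (Fin.succ i) U) (Fin.cons c x) := by
  rw [laplacian_eq_sum_partialDeriv_partialDeriv (hU.timeSlice c)]
  refine Finset.sum_congr rfl fun i _ => ?_
  rw [partialDeriv_succ_cons, timeSlice_partialDeriv_succ]

/-- **Convective derivative of slices**: for `C¹` `W`,
`((timeSlice V c)·∇)(timeSlice W c) x = ∑_j (V (Fin.cons c x))_j • ∂_{j+1} W (Fin.cons c x)`. [folklore] -/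
theorem convect_timeSlice {V : UnitAddTorus (Fin (n + 1)) → EuclideanSpace ℝ (Fin n)}
    {W : UnitAddTorus (Fin (n + 1)) → F} (hW : IsSmooth W) (c : UnitAddCircle) (x : UnitAddTorus (Fin n)) :
    convect (timeSlice V c) (timeSlice W c) x =
      ∑ j : Fin n, (V (Fin.cons c x)) j • partialDeriv (Fin.succ j) W (Fin.cons c x) := by
  rw [Torus.convect, fderiv_apply_eq_sum_partialDeriv ((hW.timeSlice c).isContDiff (by simp))]
  refine Finset.sum_congr rfl fun j _ => ?_
  rw [timeSlice_apply, partialDeriv_succ_cons]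

/-- **Gradient of a slice**: for `C¹` scalar `Q`, `(∇ (timeSlice Q c) x)_i = ∂_{i+1} Q (Fin.cons c x)`.
[folklore] -/
theorem gradient_timeSlice_apply {Q : UnitAddTorus (Fin (n + 1)) → ℝ} (hQ : IsSmooth Q) (c : UnitAddCircle)
    (x : UnitAddTorus (Fin n)) (i : Fin n) :
    gradient (timeSlice Q c) x i = partialDeriv (Fin.succ i) Q (Fin.cons c x) := by
  have h := inner_gradient_eq_sum_mul_partialDeriv ((hQ.timeSlice c).isContDiff (by simp))
    (EuclideanSpace.single i (1 : ℝ)) x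
  rw [EuclideanSpace.inner_single_left, map_one, one_mul] at h
  rw [h, Finset.sum_eq_single i (fun j _ hji => by simp [hji]) (by simp), partialDeriv_succ_cons]
  simp

/-- **Divergence of a slice**: `div (timeSlice V c) x = ∑_i ∂_{i+1} (V·)_i (Fin.cons c x)`. [folklore] -/
theorem divergence_timeSlice (V : UnitAddTorus (Fin (n + 1)) → EuclideanSpace ℝ (Fin n)) (c : UnitAddCircle)
    (x : UnitAddTorus (Fin n)) :
    divergence (timeSlice V c) x = ∑ i : Fin n, partialDeriv (Fin.succ i) (fun y => V y i) (Fin.cons c x) := by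
  rw [divergence]
  refine Finset.sum_congr rfl fun i _ => ?_
  rw [partialDeriv_succ_cons]
  rfl

end Deriv

/-! ## Fubini on `T^{1+n} = T¹ × T^n` and the slice formula for Fourier coefficients -/

section Fubini

/-- `(z₁, z₂) ↦ Fin.cons z₁ z₂` is continuous. [folklore] -/
theorem continuous_cons_prod :
    Continuous fun z : UnitAddCircle × UnitAddTorus (Fin n) => (Fin.cons z.1 z.2 : UnitAddTorus (Fin (n + 1))) := by
  refine continuous_pi fun i => ?_
  refine Fin.cases ?_ (fun j => ?_) i
  · simp only [Fin.cons_zero]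
    exact continuous_fst
  · simp only [Fin.cons_succ]
    exact (continuous_apply j).comp continuous_snd

variable [NormedAddCommGroup F] [NormedSpace ℝ F]

/-- **Fubini on the product torus**: for continuous `Φ` on `T^{1+n}`,
`∫_{T^{1+n}} Φ = ∫_{T¹} ∫_{T^n} Φ (Fin.cons s x) dx ds` (Mathlib's
`volume_preserving_piFinSuccAbove` at the index `0` and `integral_prod`). [folklore] -/
theorem integral_eq_integral_cons [CompleteSpace F] (Φ : UnitAddTorus (Fin (n + 1)) → F) (hΦ : Continuous Φ) :
    ∫ y, Φ y = ∫ s : UnitAddCircle, ∫ x : UnitAddTorus (Fin n), Φ (Fin.cons s x) := by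
  have hmp := measurePreserving_piFinSuccAbove (fun _ : Fin (n + 1) => (volume : Measure UnitAddCircle)) 0
  have hΨc : Continuous fun z : UnitAddCircle × UnitAddTorus (Fin n) => Φ (Fin.cons z.1 z.2) :=
    hΦ.comp continuous_cons_prod
  have hΨi : Integrable (fun z : UnitAddCircle × UnitAddTorus (Fin n) => Φ (Fin.cons z.1 z.2))
      ((volume : Measure UnitAddCircle).prod (Measure.pi fun _ : Fin n => (volume : Measure UnitAddCircle))) :=
    hΨc.integrable_of_hasCompactSupport (HasCompactSupport.of_compactSpace _)
  have hvol : (volume : Measure (UnitAddTorus (Fin (n + 1)))) =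
      Measure.pi fun _ : Fin (n + 1) => (volume : Measure UnitAddCircle) := rfl
  have h1 : ∫ y, Φ y = ∫ y : UnitAddTorus (Fin (n + 1)),
      (fun z : UnitAddCircle × UnitAddTorus (Fin n) => Φ (Fin.cons z.1 z.2))
        (MeasurableEquiv.piFinSuccAbove (fun _ : Fin (n + 1) => UnitAddCircle) 0 y) := by
    congr 1
    funext y
    change Φ y = Φ (Fin.cons (y 0) fun j => y (Fin.succAbove 0 j))
    simp only [Fin.succAbove_zero]
    exact congrArg Φ (Fin.cons_self_tail y).symm
  have h2 := hmp.integral_comp' (fun z : UnitAddCircle × UnitAddTorus (Fin n) => Φ (Fin.cons z.1 z.2))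
  rw [h1, hvol, h2]
  exact integral_prod _ hΨi

/-- The characters of `T^{1+n}` factor into a time character and a space character:
`e_{(m,k)}(s, x) = e_m(s) e_k(x)`. [folklore] -/
theorem mFourier_cons (m : ℤ) (k : Fin n → ℤ) (s : UnitAddCircle) (x : UnitAddTorus (Fin n)) :
    mFourier (Fin.cons m k) (Fin.cons s x : UnitAddTorus (Fin (n + 1))) = fourier m s * mFourier k x := by
  simp only [mFourier, ContinuousMap.coe_mk, Fin.prod_univ_succ, Fin.cons_zero, Fin.cons_succ]

/-- Negation of a `Fin.cons` frequency. [folklore] -/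
theorem neg_cons (m : ℤ) (k : Fin n → ℤ) : -(Fin.cons m k : Fin (n + 1) → ℤ) = Fin.cons (-m) (-k) := by
  funext i
  refine Fin.cases ?_ (fun j => ?_) i <;> simp

/-- Difference of `Fin.cons` frequencies. [folklore] -/
theorem cons_sub_cons (m m' : ℤ) (k k' : Fin n → ℤ) :
    (Fin.cons m k : Fin (n + 1) → ℤ) - Fin.cons m' k' = Fin.cons (m - m') (k - k') := by
  funext i
  refine Fin.cases ?_ (fun j => ?_) i <;> simp

variable {V : Type*} [NormedAddCommGroup V] [NormedSpace ℂ V] [CompleteSpace V]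

/-- **The slice formula for Fourier coefficients on `T^{1+n}`**: for continuous `Φ`,
`𝓕Φ(m, k) = ∫_{T¹} e_{-m}(s) • 𝓕(timeSlice Φ s)(k) ds`. [folklore] -/
theorem mFourierCoeff_cons (Φ : UnitAddTorus (Fin (n + 1)) → V) (hΦ : Continuous Φ) (m : ℤ) (k : Fin n → ℤ) :
    mFourierCoeff Φ (Fin.cons m k) =
      ∫ s : UnitAddCircle, (fourier (-m) s : ℂ) • mFourierCoeff (timeSlice Φ s) k := by
  have hc : Continuous fun y : UnitAddTorus (Fin (n + 1)) => mFourier (-Fin.cons m k) y • Φ y :=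
    (mFourier _).continuous.smul hΦ
  rw [mFourierCoeff_eq_integral_volume, integral_eq_integral_cons _ hc]
  congr 1
  funext s
  rw [mFourierCoeff_eq_integral_volume, ← integral_smul]
  congr 1
  funext x
  rw [timeSlice_apply, smul_smul, neg_cons, mFourier_cons]

/-- **The character integral on the circle**: `∫_{T¹} e_m = 1` if `m = 0`, else `0`. [folklore] -/
theorem integral_fourier_unitAddCircle (m : ℤ) :
    ∫ s : UnitAddCircle, (fourier m s : ℂ) = if m = 0 then 1 else 0 := by
  split_ifs with hm
  · subst hm
    simp only [fourier_zero]
    rw [integral_const, probReal_univ, one_smul]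
  · exact integral_eq_zero_of_add_right_eq_neg fun x => fourier_add_half_inv_index hm zero_lt_one x

/-- **Functions with constant slice coefficient**: if `𝓕(timeSlice Φ s)(k) = C` for every `s`, then
`𝓕Φ(m, k) = C` for `m = 0` and `= 0` otherwise. [folklore] -/
theorem mFourierCoeff_cons_of_timeSlice (Φ : UnitAddTorus (Fin (n + 1)) → V) (hΦ : Continuous Φ)
    {k : Fin n → ℤ} {C : V} (h : ∀ s : UnitAddCircle, mFourierCoeff (timeSlice Φ s) k = C) (m : ℤ) :
    mFourierCoeff Φ (Fin.cons m k) = if m = 0 then C else 0 := by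
  rw [mFourierCoeff_cons Φ hΦ m k]
  simp_rw [h]
  rw [integral_smul_const, integral_fourier_unitAddCircle]
  by_cases hm : m = 0 <;> simp [hm]

/-- **Time-independent functions**: `𝓕(g ∘ tail)(m, k) = 𝓕g(k)` for `m = 0`, else `0`. [folklore] -/
theorem mFourierCoeff_comp_tail {g : UnitAddTorus (Fin n) → V} (hg : Continuous g) (m : ℤ) (k : Fin n → ℤ) :
    mFourierCoeff (fun y : UnitAddTorus (Fin (n + 1)) => g (Fin.tail y)) (Fin.cons m k) =
      if m = 0 then mFourierCoeff g k else 0 :=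
  mFourierCoeff_cons_of_timeSlice _ (hg.comp (continuous_pi fun _ => continuous_apply _))
    (fun _ => rfl) m

omit [CompleteSpace V] in
/-- The zero-th coefficient is the integral (the mean). [folklore] -/
theorem mFourierCoeff_zero_eq_integral_of_normedSpace {d : Type*} [Fintype d] (g : UnitAddTorus d → V) :
    mFourierCoeff g 0 = ∫ x, g x := by
  rw [mFourierCoeff_eq_integral_volume]
  simp [neg_zero, mFourier_zero]

/-- **Zero spatial modes are time coefficients of the slice means**: if every slice of `Φ` has
mean `M` then `𝓕Φ(m, 0) = M` for `m = 0` and `= 0` otherwise. [folklore] -/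
theorem mFourierCoeff_cons_zero_of_integral_timeSlice (Φ : UnitAddTorus (Fin (n + 1)) → V) (hΦ : Continuous Φ)
    {M : V} (h : ∀ s : UnitAddCircle, ∫ x, timeSlice Φ s x = M) (m : ℤ) :
    mFourierCoeff Φ (Fin.cons m 0) = if m = 0 then M else 0 :=
  mFourierCoeff_cons_of_timeSlice Φ hΦ (fun s => by rw [mFourierCoeff_zero_eq_integral_of_normedSpace, h s]) m

end Fubini

/-! ## Conjugate symmetry of the coefficients of real fields -/

section Conj

variable {d : Type*} [Fintype d] {ι : Type*} [Fintype ι]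

/-- **The Fourier coefficients of a complexified real field `u : T^d → ℝ^ι` are conjugate
symmetric**: `𝓕u(−K) = conj 𝓕u(K)` (coordinatewise `Torus.mFourierCoeff_ofReal_comp`). [folklore] -/
theorem conjVec_mFourierCoeff_complexify {u : UnitAddTorus d → EuclideanSpace ℝ ι} (hu : Integrable u volume)
    (K : d → ℤ) :
    mFourierCoeff (EuclideanSpace.complexify ∘ u) (-K) =
      EuclideanSpace.conjVec (mFourierCoeff (EuclideanSpace.complexify ∘ u) K) := by
  have hi : Integrable (EuclideanSpace.complexify ∘ u) volume :=
    (EuclideanSpace.complexify (ι := ι)).toContinuousLinearMap.integrable_comp hu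
  ext i
  rw [mFourierCoeff_apply_euclidean hi, EuclideanSpace.conjVec_apply, mFourierCoeff_apply_euclidean hi]
  exact mFourierCoeff_ofReal_comp (fun x => u x i) K

end Conj

/-! ## Sums over `ℤ^{1+n}` as sums over `ℤ × ℤ^n` -/

section Lattice

/-- **Reindexing along `Fin.cons`**: `∑_{K ∈ ℤ^{1+n}} f(K) = ∑_{(m,k) ∈ ℤ × ℤ^n} f(Fin.cons m k)`
(`Equiv.tsum_eq` for `Fin.consEquiv`). [folklore] -/
theorem tsum_eq_tsum_cons {E : Type*} [AddCommMonoid E] [TopologicalSpace E] (f : (Fin (n + 1) → ℤ) → E) :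
    ∑' K : Fin (n + 1) → ℤ, f K = ∑' p : ℤ × (Fin n → ℤ), f (Fin.cons p.1 p.2) :=
  ((Fin.consEquiv fun _ : Fin (n + 1) => ℤ).tsum_eq f).symm

/-- Summability transfers along `Fin.cons`. [folklore] -/
theorem summable_cons_iff {E : Type*} [AddCommMonoid E] [TopologicalSpace E] (f : (Fin (n + 1) → ℤ) → E) :
    (Summable fun p : ℤ × (Fin n → ℤ) => f (Fin.cons p.1 p.2)) ↔ Summable f :=
  (Fin.consEquiv fun _ : Fin (n + 1) => ℤ).summable_iff (f := f)

/-- `|K|²` of a `Fin.cons` frequency: `|(m, k)|² = m² + |k|²`. [folklore] -/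
theorem freqNormSq_cons (m : ℤ) (k : Fin n → ℤ) :
    freqNormSq (Fin.cons m k : Fin (n + 1) → ℤ) = ((m : ℤ) : ℝ) ^ 2 + freqNormSq k := by
  simp only [freqNormSq, Fin.sum_univ_succ, Fin.cons_zero, Fin.cons_succ]

end Lattice

end Torus

end Literature.Analysis.FunctionSpaces
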